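import Summits.RiemannHypothesis.RiemannHypothesis.Theorems.GroundBartaEvenWinsBeyondArchDeflationN83OLast
import Summits.RiemannHypothesis.RiemannHypothesis.Theorems.WeilFormatCDataO865OddRung
import Summits.RiemannHypothesis.RiemannHypothesis.Theorems.WeilParityEvenWinsBeyondArchFrontierCell8OfBlocks
import Summits.RiemannHypothesis.RiemannHypothesis.Theorems.GroundBartaEvenWinsBeyondArchUpper865Sharp
import Summits.RiemannHypothesis.RiemannHypothesis.Theorems.WeilFormatCDataO91OddRung
import Summits.RiemannHypothesis.RiemannHypothesis.Theorems.WeilGroundStateGroundStateSimpleEvenCellTransfer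
import Literature.NumberTheory.LFunctions.WeilGroundEnergyParitySplit
import HarnessLib

/-!
# RiemannHypothesis / GroundBarta — the parity ladder: PARITY CELL 9 `(173/200, 91/100]` CLOSED

Helper file (`--supports stmt-RiemannHypothesis-18085`, `NoParityCrossing`), RH-free.  Prover A (g22 of unit `sr-gb-rung-a`).

The ladder step on `[173/200, 91/100]` (`ε`, `ε_od` antitone; `GroundStateSimpleEven.weilWindowSimpleEven_on_cell_of_le`, the
mechanism of `…LadderStep`'s `weilWindowSimpleEven_upTo_step`, inlined here) from three tree facts:
* the ladder up to `173/200` (cells 7 + 8): `n83O_oddLower_lit`, `WeilFormatCData.O865.weilOddGroundEnergy_865_ge_inv_two_pow_60` and prover B g8's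
  `weilWindowSimpleEven_upTo_cell8_of_oddLowers` — i.e. `weilWindowSimpleEven_upTo_865` of `…ParityCell865`, re-derived inline (that module is reload-stranded on the hub);
* the U-side at `173/200`: `trialUpper865sharp : ε(173/200) ≤ 705·10⁻²³` (`…Upper865Sharp`, Ritz vector `ne865v1`);
* the L-side at `91/100`: `WeilFormatCData.O91.weilOddGroundEnergy_91_ge_five_div_two_pow_69 : 5·2⁻⁶⁹ ≤ ε_od(91/100)`
  (`WeilFormatCDataO91OddRung`, the format-C ODD λ-run at `a = 91/100`, odd block `160`, `μ = 5·2⁻⁶⁹ = 8.47·10⁻²¹ > 705·10⁻²³`).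

* `weilWindowSimpleEven_upTo_91` — for every `0 < a ≤ 91/100` the ground state of the windowed Weil form is simple and even;
* `weilEvenGroundEnergy_lt_weilOddGroundEnergy_upTo_91`, `tailSimpleEven_upTo_91` — the strict parity order / the item-18085 tail shape.

Standard axioms; nothing is defined; no RH claim (a finite-range parity certificate).
-/

set_option linter.dupNamespace false

noncomputable section

open Set MeasureTheory

namespace Summit.RiemannHypothesis.RiemannHypothesis.Theorems.EvenWinsBeyondArch

open Literature.NumberTheory.LFunctions

/-- **Parity cell 9 closed: the ladder reaches `91/100`.**  For every window `0 < a ≤ 91/100` the windowed Weil form has a simple,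
even ground state. [folklore] -/
theorem weilWindowSimpleEven_upTo_91 : ∀ a : ℝ, 0 < a → a ≤ 91 / 100 → WeilWindowSimpleEven a := by
  intro a ha hac
  rcases le_or_gt a (173 / 200) with hab | hba
  · -- the ladder up to `173/200` (cell 8), re-derived inline from the landed cell-7/cell-8 odd lower bounds (prover B g19: the
    -- module `…ParityCell865` (p418099, `weilWindowSimpleEven_upTo_865`) is accepted but reload-stranded on the hub, so it is not imported)
    exact weilWindowSimpleEven_upTo_cell8_of_oddLowers (L₇ := (2 : ℝ) / 10 ^ 17) (L₈ := (1 / 2 ^ 60 : ℝ)) (by norm_num)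
      n83O_oddLower_lit (by norm_num) WeilFormatCData.O865.weilOddGroundEnergy_865_ge_inv_two_pow_60 a ha hab
  · have hU := trialUpper865sharp
    have hL := WeilFormatCData.O91.weilOddGroundEnergy_91_ge_five_div_two_pow_69
    have hUL : (705 / 100000000000000000000000 : ℝ) < (5 : ℝ) / 2 ^ 69 := by norm_num
    exact GroundStateSimpleEven.weilWindowSimpleEven_on_cell_of_le (b := 173 / 200) (c := 91 / 100) (by norm_num) hUL hU
      (fun _ hg hs hn ho ↦ hL.trans (weilOddGroundEnergy_le hg hs ho hn)) hba.le hac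

/-- The strict parity order `ε_ev(a) < ε_od(a)` for every `0 < a ≤ 91/100`. [folklore] -/
theorem weilEvenGroundEnergy_lt_weilOddGroundEnergy_upTo_91 {a : ℝ} (ha : 0 < a) (hle : a ≤ 91 / 100) :
    weilEvenGroundEnergy a < weilOddGroundEnergy a :=
  (weilWindowSimpleEven_iff_weilEvenGroundEnergy_lt ha).1 (weilWindowSimpleEven_upTo_91 a ha hle)

/-- Tail shape of item 18085 up to `91/100`: simple even ground states on every window `log 2 < a ≤ 91/100`. [folklore] -/
theorem tailSimpleEven_upTo_91 : ∀ a : ℝ, Real.log 2 < a → a ≤ 91 / 100 → WeilWindowSimpleEven a :=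
  fun a ha hle ↦ weilWindowSimpleEven_upTo_91 a ((Real.log_pos (by norm_num)).trans ha) hle

end Summit.RiemannHypothesis.RiemannHypothesis.Theorems.EvenWinsBeyondArch

end
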